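import Summits.QuantumAdvantage.QuantumAdvantage.Theorems.SosSandwichPseudoBoundedTopPairingContractionPadded
import HarnessLib

/-!
# Crux `PseudoBoundedAA` (stmt-QuantumAdvantage-15237) / item `HomogeneousPBAAT` (stmt-27399): the uniform contraction
# bound proves Aaronson–Ambainis on ALL bounded top-homogeneous polynomials (not only on `K_T`)

Third part of the calibration `Theorems/SosSandwichPseudoBoundedTopPairingContraction{,Padded}.lean` of the proposed
replacement line for the dead stub `stub_homogeneousRung` of `Cruxes/PseudoBoundedAA/Lines/birth.lean`.  The route
item `HomogeneousPBAAT` (stmt-27399) asks for `∃ c C, Inf ≥ C (Var/T)^c` on TOP-HOMOGENEOUS members of the SOS class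
`K_T` (Laplacian eigen-equation `Σᵢ (p − p∘flipᵢ) = 4T (p − E p)`); `TopPairing.homogeneousPBAAT_of_contractionBound`
derives it from the UNIFORM CONTRACTION BOUND.  Here, in the tree's own AA vocabulary (`boolVariance`, `influence`):

* `homogeneousAA_of_uniformContraction` — under the uniform contraction bound with constant `K(·)`, EVERY real
  polynomial `p` of total degree `≤ 2T` with `0 ≤ p ≤ 1` on the cube whose centred part obeys the Laplacian
  eigen-equation of order `T` (Walsh level exactly `2T`) and `Var[p] > 0` has a variable with
  **`16 · Var[p]² ≤ K(2T) · Inf_k[p]`** — NO pseudo-boundedness assumed;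
* `homogeneousAA_of_uniformContraction_poly` — with `K(T) = A·T^a`: `(16/(A·2^a)) · Var[p]²/T^a ≤ Inf_k[p]`.

So a polynomial uniform contraction constant would settle the Aaronson–Ambainis conjecture on the whole class of
bounded top-homogeneous polynomials of even degree — which contains the block-multilinear (fully decoupled) forms of
even degree, the class on which AA is OPEN (known under complete boundedness only: Bansal–Sinha–de Wolf
arXiv:2203.00212, Escudero Gutiérrez arXiv:2304.06713 Thm 1.6) and already sufficient for AA14's Quantum Conjecture
(Aaronson–Ambainis 2015, recorded in O'Donnell–Zhao arXiv:1512.01603 Remark 2.14).  Proof: apply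
`exists_influence_ge_topWeight_sq_of_uniformContraction` at order `2T` to `g = 2p − 1` (`g² ≤ 1`,
`ĝ(S) = 2p̂(S)` for `S ≠ ∅`, `W^{=2T}[g] = 4·Var[p]` by `boolVariance_eq_topWeight_of_laplacian`, `Inf[g] = 4·Inf[p]`).
Honest label: calibration of a proposed line (hypothesis ⟹ consequence); proves neither 27399 nor the crux; no
registered stub is closed.  Finite sums only; no named facts.
Sources: AaronsonAmbainis2014 Conj. 6; EscuderoGutierrez2023 Thm 1.6 / Question 4.5; ODonnellZhao2016 Remark 2.14;
BansalSinhaDeWolf2022; ODonnell2014 §1.4, §2.2.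
-/

set_option linter.dupNamespace false

noncomputable section

namespace Summit.QuantumAdvantage.QuantumAdvantage.Theorems.SosSandwich

open Finset MvPolynomial Literature.Computability.QuantumComplexity
open Literature.Computability.Complexity.LowDegree Literature.Probability.RandomGraphs.LowDegree

namespace TopPairing

variable {N : ℕ}

/-! ### The affine rescaling `g = 2p − 1` -/

/-- Values of `2p − 1`. [folklore] -/
theorem evalBool_twoMulSubOne (p : MvPolynomial (Fin N) ℝ) (x : Fin N → Bool) :
    evalBool (C 2 * p - 1) x = 2 * evalBool p x - 1 := by
  rw [AddrWitness.evalBool_sub', AddrWitness.evalBool_C_mul', AddrWitness.evalBool_one']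

/-- `0 ≤ p ≤ 1` on the cube gives `(2p − 1)² ≤ 1`. [folklore] -/
theorem evalBool_twoMulSubOne_sq_le (p : MvPolynomial (Fin N) ℝ)
    (hp01 : ∀ x, 0 ≤ evalBool p x ∧ evalBool p x ≤ 1) (x : Fin N → Bool) :
    evalBool (C 2 * p - 1) x ^ 2 ≤ 1 := by
  rw [evalBool_twoMulSubOne]
  obtain ⟨h0, h1⟩ := hp01 x
  nlinarith

/-- Walsh coefficients of `2p − 1` off the empty set: `(2p−1)^(S) = 2·p̂(S)`. [cite: ODonnell2014, §1.4] -/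
theorem cubeFourierCoeff_twoMulSubOne (p : MvPolynomial (Fin N) ℝ) {S : Finset (Fin N)} (hS : S ≠ ∅) :
    cubeFourierCoeff (evalBool (C 2 * p - 1)) S = 2 * cubeFourierCoeff (evalBool p) S := by
  have hfun : evalBool (C 2 * p - 1) = fun x => (fun y => 2 * evalBool p y) x - (fun _ => (1 : ℝ)) x :=
    funext fun x => by rw [evalBool_twoMulSubOne]
  rw [hfun, cubeFourierCoeff_sub, cubeFourierCoeff_const_mul, cubeFourierCoeff_const hS, sub_zero]

/-- Influences of `2p − 1`: `Inf_k[2p − 1] = 4·Inf_k[p]`. [cite: ODonnell2014, §2.2] -/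
theorem influence_twoMulSubOne (p : MvPolynomial (Fin N) ℝ) (k : Fin N) :
    influence k (C 2 * p - 1) = 4 * influence k p := by
  unfold influence boolAvg
  rw [mul_div_assoc', Finset.mul_sum]
  congr 1
  refine Finset.sum_congr rfl fun x _ => ?_
  show (evalBool (C 2 * p - 1) x - evalBool (C 2 * p - 1) (flipBit k x)) ^ 2 =
    4 * (evalBool p x - evalBool p (flipBit k x)) ^ 2
  rw [evalBool_twoMulSubOne, evalBool_twoMulSubOne]
  ring

/-- The degree-`2T` top weight of `2p − 1` is `4 ×` that of `p` (`T ≥ 1`, so `|S| = 2T` forces `S ≠ ∅`). [folklore] -/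
theorem topWeight_twoMulSubOne {T : ℕ} (hT : 1 ≤ T) (p : MvPolynomial (Fin N) ℝ) :
    ∑ S ∈ Finset.univ.filter (fun S : Finset (Fin N) => S.card = 2 * T),
        cubeFourierCoeff (evalBool (C 2 * p - 1)) S ^ 2 =
      4 * ∑ S ∈ Finset.univ.filter (fun S : Finset (Fin N) => S.card = 2 * T),
        cubeFourierCoeff (evalBool p) S ^ 2 := by
  rw [Finset.mul_sum]
  refine Finset.sum_congr rfl fun S hS => ?_
  rw [Finset.mem_filter] at hS
  have hS0 : S ≠ ∅ := by
    intro h; rw [h, Finset.card_empty] at hS; omega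
  rw [cubeFourierCoeff_twoMulSubOne p hS0]
  ring

/-! ### AA on all bounded top-homogeneous polynomials from the uniform contraction bound -/

/-- **The uniform contraction bound proves Aaronson–Ambainis on ALL bounded top-homogeneous polynomials.**  Under the
uniform contraction bound with constant `K(·)` (inline hypothesis of `TopPairing.homogeneousPBAAT_of_contractionBound`,
generalised to a constant `K T`), every real polynomial `p` of total degree `≤ 2T` (`T ≥ 1`) with `0 ≤ p ≤ 1` on the
cube, centred part on Walsh level exactly `2T` (Laplacian eigen-equation of order `T`) and `Var[p] > 0` has a
variable with `16·Var[p]² ≤ K(2T)·Inf_k[p]`.  No pseudo-boundedness is assumed: this is AA on the whole bounded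
top-homogeneous class (⊇ even-degree block-multilinear forms), an open case of `AAConjecture`.
[cite: AaronsonAmbainis2014, Conj. 6] [cite: ODonnellZhao2016, Remark 2.14] [cite: EscuderoGutierrez2023, Question 4.5] -/
theorem homogeneousAA_of_uniformContraction (K : ℕ → ℝ)
    (h : ∀ (N T m : ℕ) (q : Fin m → MvPolynomial (Fin N) ℝ) (p : MvPolynomial (Fin N) ℝ), 1 ≤ T →
      (∀ j, (q j).totalDegree ≤ T) → (∀ x, evalBool p x = ∑ j, evalBool (q j) x ^ 2) →
      (∀ x, evalBool p x ≤ 1) →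
      ∀ (c : Finset (Fin N) → ℝ) (M : ℝ),
        (∀ k : Fin N, ∑ U ∈ Finset.univ.filter (fun U : Finset (Fin N) => U.card = 2 * T ∧ k ∈ U), c U ^ 2 ≤ M) →
        ∑ j, ∑ R ∈ Finset.univ.filter (fun R : Finset (Fin N) => R.card = T),
          (∑ U ∈ Finset.univ.filter (fun U : Finset (Fin N) => U.card = 2 * T ∧ R ⊆ U),
            c U * cubeFourierCoeff (evalBool (q j)) (U \ R)) ^ 2 ≤ K T * M)
    (hK0 : ∀ T, 0 ≤ K T)
    {T : ℕ} (hT : 1 ≤ T) (p : MvPolynomial (Fin N) ℝ) (hdeg : p.totalDegree ≤ 2 * T)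
    (hp01 : ∀ x, 0 ≤ evalBool p x ∧ evalBool p x ≤ 1)
    (hhom : ∀ x : Fin N → Bool, ∑ i : Fin N, (evalBool p x - evalBool p (Function.update x i (!x i))) =
      4 * (T : ℝ) * (evalBool p x - boolAvg (evalBool p)))
    (hvar : 0 < boolVariance p) :
    ∃ k : Fin N, 16 * boolVariance p ^ 2 ≤ K (2 * T) * influence k p := by
  set g : MvPolynomial (Fin N) ℝ := C 2 * p - 1 with hg
  have hdeg' : g.totalDegree ≤ 2 * T := by
    refine (totalDegree_sub _ _).trans (max_le ((totalDegree_mul _ _).trans ?_) ?_)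
    · rw [totalDegree_C, zero_add]; exact hdeg
    · rw [totalDegree_one]; exact Nat.zero_le _
  have hg1 : ∀ x, evalBool g x ^ 2 ≤ 1 := evalBool_twoMulSubOne_sq_le p hp01
  have hvarW := boolVariance_eq_topWeight_of_laplacian hT p hhom
  have hWg : ∑ S ∈ Finset.univ.filter (fun S : Finset (Fin N) => S.card = 2 * T),
      cubeFourierCoeff (evalBool g) S ^ 2 = 4 * boolVariance p := by
    rw [hvarW]; exact topWeight_twoMulSubOne hT p
  have hW : 0 < ∑ S ∈ Finset.univ.filter (fun S : Finset (Fin N) => S.card = 2 * T),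
      cubeFourierCoeff (evalBool g) S ^ 2 := by rw [hWg]; linarith
  have h2T : 1 ≤ 2 * T := by omega
  obtain ⟨k, hk⟩ := exists_influence_ge_topWeight_sq_of_uniformContraction K h hK0 h2T g hdeg' hg1 hW
  refine ⟨k, ?_⟩
  rw [hWg, influence_twoMulSubOne] at hk
  nlinarith [hk]

/-- **Polynomial constants.**  If the uniform contraction bound holds with `K(T) = A·T^a`, then every bounded
top-homogeneous `p` as above has a variable with `(16 / (A · 2^a)) · (Var[p]² / T^a) ≤ Inf_k[p]` — the
`HomogeneousPBAAT`-shaped conclusion (`C·(Var/T)^c`-type bound, here with `Var²/T^a`) on ALL bounded top-homogeneous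
polynomials, not only on `K_T`. [cite: AaronsonAmbainis2014, Conj. 6] [cite: EscuderoGutierrez2023, Question 4.5] -/
theorem homogeneousAA_of_uniformContraction_poly (a : ℕ) (A : ℝ) (hA : 0 < A)
    (h : ∀ (N T m : ℕ) (q : Fin m → MvPolynomial (Fin N) ℝ) (p : MvPolynomial (Fin N) ℝ), 1 ≤ T →
      (∀ j, (q j).totalDegree ≤ T) → (∀ x, evalBool p x = ∑ j, evalBool (q j) x ^ 2) →
      (∀ x, evalBool p x ≤ 1) →
      ∀ (c : Finset (Fin N) → ℝ) (M : ℝ),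
        (∀ k : Fin N, ∑ U ∈ Finset.univ.filter (fun U : Finset (Fin N) => U.card = 2 * T ∧ k ∈ U), c U ^ 2 ≤ M) →
        ∑ j, ∑ R ∈ Finset.univ.filter (fun R : Finset (Fin N) => R.card = T),
          (∑ U ∈ Finset.univ.filter (fun U : Finset (Fin N) => U.card = 2 * T ∧ R ⊆ U),
            c U * cubeFourierCoeff (evalBool (q j)) (U \ R)) ^ 2 ≤ A * (T : ℝ) ^ a * M)
    {T : ℕ} (hT : 1 ≤ T) (p : MvPolynomial (Fin N) ℝ) (hdeg : p.totalDegree ≤ 2 * T)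
    (hp01 : ∀ x, 0 ≤ evalBool p x ∧ evalBool p x ≤ 1)
    (hhom : ∀ x : Fin N → Bool, ∑ i : Fin N, (evalBool p x - evalBool p (Function.update x i (!x i))) =
      4 * (T : ℝ) * (evalBool p x - boolAvg (evalBool p)))
    (hvar : 0 < boolVariance p) :
    ∃ k : Fin N, 16 / (A * 2 ^ a) * (boolVariance p ^ 2 / (T : ℝ) ^ a) ≤ influence k p := by
  have hK0 : ∀ T : ℕ, 0 ≤ A * (T : ℝ) ^ a := fun T => by positivity
  obtain ⟨k, hk⟩ := homogeneousAA_of_uniformContraction (fun T : ℕ => A * (T : ℝ) ^ a) h hK0 hT p hdeg hp01 hhom hvar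
  refine ⟨k, ?_⟩
  have hTpos : (0 : ℝ) < (T : ℝ) := by exact_mod_cast (show 0 < T by omega)
  have hden : (0 : ℝ) < A * 2 ^ a * (T : ℝ) ^ a := by positivity
  have hk' : 16 * boolVariance p ^ 2 ≤ A * 2 ^ a * (T : ℝ) ^ a * influence k p := by
    have h2 : (A * ((2 * T : ℕ) : ℝ) ^ a) = A * 2 ^ a * (T : ℝ) ^ a := by push_cast; rw [mul_pow]; ring
    rw [← h2]; exact hk
  rw [div_mul_div_comm, div_le_iff₀ hden]
  linarith [hk']

end TopPairing

end Summit.QuantumAdvantage.QuantumAdvantage.Theorems.SosSandwich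

end
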